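import Literature.MathematicalPhysics.QuantumFieldTheory.Balaban1983to89.B4Sect5Proof
import Literature.MathematicalPhysics.QuantumFieldTheory.Balaban1983to89.B4Gauss33Proof
import Literature.MathematicalPhysics.QuantumFieldTheory.Balaban1983to89.B4GaussRep36Proof
import Literature.MathematicalPhysics.QuantumFieldTheory.Balaban1983to89.DagBinding

/-!
# `Balaban1983to89.B4Carve42Sects345Hyp` — [Balaban1983RegularityDecay] pp. 586–597 (Sects. 3–5: «3. Proof of
# Proposition 2.3 of [1]» (3.1)–(3.10) pp. 586–589, «4. Proof of the Lower Bound for the Quadratic Form Δ^{(k)}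
# (Proposition 3.1′)» (4.1)–(4.22) pp. 589–593, «5. A General Theorem on Unit Lattice Operators» (5.1)–(5.27)
# pp. 593–597 with the THEOREM p. 594): P6 CARVING-FAN BLOCK 42 — the block's sentence census (residual EMPTY) and
# ONE hypothesis bundle `Hyp` of the pages' printed statements BY NAME, keyed to the consumer
# (`stmt-QuantumFields-20542`, K1⁷; DAG leaf `b4` of `DagBinding.Upstream.ofPrinted` = `B4.LeafB4 …`)

statement-level skeleton of published theorems with citation tags; proofs where landed; nothing here is a claim about the
Yang–Mills mass gap

T. Bałaban, *Regularity and decay of lattice Green's functions*, Commun. Math. Phys. **89** (1983) 571–597,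
doi:10.1007/bf01214744 `[Balaban1983RegularityDecay]` (cell paper "B4"; journal page = PDF page + 570).  STATUS:
published, refereed.  PDF held: `paper:balaban1983-cmp89-regularity-decay`; pp. 586–597 [PDF 16–27] read by this seat AS
IMAGES (renders `run/shared/lean/pub/pub-balaban/b2b-balaban-ref1/pages/1983-cmp89-regularity-decay/1983-cmp89-regularity-
decay-p016-x2.png` … `-p027-x2.png`, 2026-08-28) and on the text layer (`lit read … --pages 16-27`, files `p0016.txt` …
`p0027.txt`; line locators `pNNNN:Ln` below).  [1], [2], [3] of the paper = (Higgs)₂,₃ I, II, III (cell context B1–B3).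
GLOBAL PRINT ERRATUM of record (`B4` module docstring): every in-text reference to a §1 display on pp. 588–590, 593 is low
by four («(1.11), (1.12), (1.16)» = (1.15), (1.16), (1.20); «(1.14)» = (1.18); «(1.18)» = (1.22); «(1.11)» p. 593 =
(1.15)).

CITATION HEADER (lean-in-tree rule).  Cell `lit-balaban` (HOME `run/shared/lean/pub/lit-balaban/`), P6 CARVING FAN
(D-0154 (3b)), RESERVE block 42 of `carve/BLOCKS-41-48.md` (lead g31 RULING #10, `carve/STATUS.md` 08:16:31Z; claimed by
seat `carve-25`, CLAIM 08:36:53Z first stamp): «[B4] Sects. 3–5: proof of Prop 2.3 (3.1)–(3.10), lower bound (4.1)–(4.22),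
Sect. 5 Thm p.594 (5.1)–(5.27); 17 SKELETON rows (proved 12, proved-existing 5); KEY stmt-QuantumFields-20542, also-feeds
20544».  RULES (`carve/CARVE-RULES.md` §2): IN TREE = CITE, NEVER RESTATE; residual printed statements in hypothesis
form `def …Printed : Prop`; ONE bundle `Hyp`; no `instance`, no `notation`, 0 `sorry`.  Neighbour: block 41 (pp. 571–585,
Sects. 1–2, where the Theorem p. 573 and «Proposition 2.3 of [1]» ∕ «Proposition 3.1′ of [2]» p. 574 are STATED; boundary
of record: (2.50)–(2.51) and «Thus we have proved Lemma 2.4, hence also the Theorem» p. 586 ll. 1–15 = block 41; this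
block starts at «3. Proof of Proposition 2.3 of [1]» p. 586 l. 16 (`p0016:L16`)).

## WHAT THE BLOCK'S PAGES PRINT AND WHERE THE TREE HOLDS IT (cite table — all 17 SKELETON rows of the block are IN
## TREE; nothing below is restated; FQ prefix `Literature.MathematicalPhysics.QuantumFieldTheory.Balaban1983to89.`)

### Sect. 3 «Proof of Proposition 2.3 of [1]», pp. 586–589 (`p0016:L16` – `p0019:L7`)
* row B4.Eq3.1 — (3.1), (3.2), (3.4) pp. 586–587 (the Gaussian representation of C^{(k)}_Λ(Ω,A) = ((Δ^{(k)}(Ω,A) +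
  aL⁻²P(A))|_Λ)⁻¹, the translation ψ → ψ + Q_k(A)φ, «The integral in the curly bracket {…} factorizes into integrals
  with respect to ψ|_{B(z)}. In these we make a gauge transformation ψ(y) → U(A(Γ_{y,z}))ψ(y) …» `p0017:L9–L12`, «using
  the recursive relation a_{k+1} = aa_k∕(aL⁻² + a_k)» `p0017:L23`, «Z is of course a normalization factor» `p0017:L30`):
  in tree `B4GaussRep36.GaussCovariance` ((3.1) first equality, its folklore content) — PROVED `B4Gauss33Proof.
  gaussCovariance` (B4Gauss33Proof.lean:151); dictionary `B4GaussRep36.cLam`, `qNext`, `aNext`, `B4.recursion_51`;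
  the block structure of the averages `B4Sect3BlockAveraging.rowOrtho_avgOp`, `blockCompatible_avgOp`.  Bundle `e31`.
* row B4.Eq3.3 — (3.3) p. 587 «We apply the general formula …»: `B4GaussRep36.Gauss33` — PROVED `B4Gauss33Proof.gauss33`
  (B4Gauss33Proof.lean:220; algebra `B4GaussRep36.gauss33_inv`, `gauss33_mean`).  Bundle `e33`.
* row B4.Eq3.5 — (3.5) p. 587 «Denoting G_k(Ω,Λ,A) = (−Δ^{η,N}_{A,Ω} + m_k² + a_kP_k(A)(Ω∖B^k(Λ)) +
  a_{k+1}L⁻²P_{k+1}(A)B^k(Λ))⁻¹»: `B4GaussRep36.kLam` ∕ `gLam` (B4GaussRep36.lean:261); `B4TwoScaleForm` (its form).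
* row B4.Eq3.6 — (3.6), (3.8) p. 588 «we have finally …»: `B4GaussRep36.Rep36` (B4GaussRep36.lean:313) — PROVED for all
  data `B4GaussRep36Proof.rep36` (B4GaussRep36Proof.lean:193), on the concrete averages `B4Sect3BlockAveraging.rep36_avgOp`;
  (3.8) ⇔ (3.6) entrywise `B4GaussRep36.eq38`.  Bundle `e36`.
* row B4.Eq3.7 — (3.7) p. 588 and «A composition of an operator T defined on the η-lattice with Q_k^*(A) or
  Q*_{k+1}(A)Q(A) can be interpreted as the action of the operator T on properly defined functions» `p0018:L4–L7`:
  `B4GaussRep36.qk`, `qk1`, `tOp_row` (B4GaussRep36.lean:325).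
* p. 588 ll. 14–16 (`p0018:L14–L16`) «The L²-norms of the functions q_k(y), q_{k+1}(y) are equal to 1, L^{−d∕2} and their
  supports are in B^k(y), B^{k+1}(z(y)) respectively, so the inequalities (1.11), (1.12), and (1.16) [= (1.15), (1.16),
  (1.20)] are simple consequences of Corollary 2.3»: `B4Sect3BlockAveraging.tOp_row_sq_le`, `avgOp_row_support`,
  `B4Cor23Rep36Bridge.qkR_diag`, `bl2n_sq`; the route `B4Prop23Sect3Route.abs_cLam_le_dist` ((1.16)),
  `B4Prop23Sect5Route.prop23_116_118_of_cor23_rep36`, `prop23_120_of_cor23_rep36`; the upper∕lower form bound (1.15) by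
  §3 `B4Ineq115Sect3Route.form115_upper`, `form115_lower`.
* p. 588 ll. 16–25 (`p0018:L16–L25`) «the corollary was proved for the propagator G_k(Ω,A), not for G_k(Ω,Λ,A), but …
  the whole proof of Corollary 2.3 goes on with only slight changes, the most important is that in the inequality (2.27)
  for Δ = B^{k+1}(z), z ∈ Λ′, we have to replace min{π², a_k} by min{π²L⁻², a_{k+1}L⁻²} … Generally we have to expect
  that bounds on C^{(k)}_Λ(Ω,A) will depend on L.» (census G-B4-04; slip G-B4-03 recurs): quoted and located in
  `B4.Prop23Printed` ∕ `B4.Display227Printed` docstrings; the two-scale block form `B4TwoScaleForm`, Cor. 2.3 for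
  G_k(Ω,Λ,A) on regions `B4Cor23Rep36Bridge.hG_regularPair`, `B4RegionCov1518`, `B4RegionCovUniformMass`.
* row B4.Eq3.9 — (3.9) p. 588: `B4GaussRep36.eq39` (PROVED with the correct overall sign, B4GaussRep36.lean:398).
* row B4.Eq3.10 — (3.10) p. 589 «and for f, f′ ∈ L²(B^k(Λ)), we get …»: `B4GaussRep36.Ineq310` (B4GaussRep36.lean:415)
  — PROVED from the decay inputs `B4Ineq310Proof.ineq310` (B4Ineq310Proof.lean:317).
* p. 589 ll. 5–7 (`p0019:L5–L7`) «The function δC^{(k)}_Λ(Ω,A) is given by (3.8) with the operator (3.9) instead of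
  G_k(Ω,Λ,A) and the inequality (3.10) implies (1.14) [= (1.18)]. This ends the proof of Proposition I.2.3. Another proof
  will be given in the last section.»: `B4Prop23Sect3Route.deltaC_apply_eq`, `abs_deltaC_le_dist` — the §3 DELIVERY
  «Proposition 2.3 of [1]» = `B4.Prop23Printed` (stated p. 574, block 41).  Bundle `prop23`.

### Sect. 4 «Proof of the Lower Bound for the Quadratic Form Δ^{(k)} (Proposition 3.1′)», pp. 589–593 (`p0019:L8` – `p0023:L12`)
* row B4.Eq4.4 — (4.1)–(4.4) p. 589 («At first we have G_k(Ω,A) ≤ ((a_kP_k(A) + m²)|_Ω)⁻¹» `p0019:L11`; «This means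
  that the integral is equal to const exp[−½(the term of the sum (4.1) corresponding to the point x)]. … gauge
  transformation φ′(x′) = U(A(Γ^{(k)}_{x′,x}))φ″(x′)» `p0019:L17–L20`; «if m² ≤ O(1). Thus a part of the inequality (1.18)
  is proved» `p0019:L27`): `B4Ineq44MassPart.ineq44_printed` (B4Ineq44MassPart.lean:113), `mass_pointwise`,
  `B4Prop31Energy.cenergy` ∕ `gStar`, bookkeeping `B4.prop31_gamma0` (B4.lean:398).
* row B4.Eq4.7 — (4.5)–(4.7) p. 590 («the set of all positively oriented bonds … can be represented as a sum of 2d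
  subsets B_i with the property that each point of Ω^{(k)} belongs to at most one bond in a given subset B_i» `p0019:
  L28–L33`; «Δ(x,x′) = B^k(x) ∪ B^k(x′). Again separating subsets of Ω by the Neumann boundary conditions» `p0019:L34–L35`;
  «Each term in the second sum of the right side (4.5) is non-negative … Summing the inequalities (4.5) over B_i» `p0020:
  L7–L9`; «it is sufficient to prove (4.7) with γ₀′ independent of k, ⟨x,x′⟩, and A. Then γ₀ = ½min{γ₀′∕2d, a_k∕(a_k +
  O(1))}» `p0020:L12–L15`): `B4Ineq45Decoupling.ineq45`, `ineq46`, `B4Ineq46Lattice.matching`, `cls`, `ineq46_printed`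
  (B4Ineq46Lattice.lean:309), `prop31_of_ineq47_ineq44`, `B4Ineq47TwoBlock.ineq47_box`, `B4.prop31_gamma0`.
* row B4.Eq4.11 — (4.8)–(4.13) pp. 590–591 («we write A = A₀ + A′ on Δ(x,x′) with A₀ constant and A′ satisfying the
  bounds |A′|, |∂^η_μA′| ≤ O(1)p(e)» `p0020:L16–L18`; «Using Lemma 2.1 the remaining terms can be easily estimated by
  O(e²p²(e))(|φ(x)|² + |φ(x′)|²)» `p0020:L18–L20`; «Denoting φ^{(k)} = a_kG_k(Δ(x,x′),A₀)Q_k^*(A₀)φ» `p0020:L25`; «we can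
  "gauge away" the configuration A₀ … Then using II.2.75 we have (4.9)» `p0020:L32–L35`; (4.10) with «(φ(x)·qφ(x) = 0
  because q is an antisymmetric matrix), for arbitrary δ > 0» `p0021:L10–L11`; «Now it is sufficient to prove the
  inequality (4.12) because this together with (4.11) with δ = ½γ₀″ and (4.13) give (4.7) with γ₀′ = ¼γ₀″. Let us notice
  that the second term on the right hand side of (4.7) does not appear if A = 0.» `p0021:L16–L23`): `B4Eq47Expansion.
  remainder411_eq`, `B4Eq48FirstOrder.firstOrder48`, `hasDerivAt_lhs47`, `B4Eq49TwoBlockGreen.eq49`, `B4Eq411Remainder.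
  ineq411_full`, `B4Ineq410FirstOrder.ineq410_first_constBond`, `B4Ineq410GaugeOut.first_order_terms_eq_zero`,
  `dotProduct_mulVec_antisymm`, `ineq410` (B4Ineq410GaugeOut.lean:169), `ineq411`, `ineq413`, `ineq47_of_412`,
  bookkeeping `B4.gamma0prime_chain` (B4.lean:430).
* row B4.Eq4.14 — (4.14)–(4.22) pp. 591–593 («At first we estimate the left side of it from below by the same expression
  with m² = 0. Further we "gauge out" the constant field A …» `p0021:L24–L28`; «const.exp[−½(the left side of (4.14))] is
  equal to the integral (4.15)» `p0021:L31`; «Denoting Δ = B^k(x), Δ′ = B^k(x′), ψ = φ″(x′) − φ″(x), and making the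
  translations …» `p0021:L35–L37`; «where B(⟨x,x′⟩) denotes the set of all bonds of the η-lattice connecting the block
  B^k(x) with the block B^k(x′)» `p0022:L4–L5`; «Now we have to show that A₀ > 0, more exactly A₀ ≥ γ₀″, γ₀″ > 0, and γ₀″
  depends on d and a only. … We can assume that φ and ψ are real quantities» `p0022:L5–L10`; (4.17); «Now it is sufficient
  to prove that 0 < A₀⁻¹ ≤ γ₀″⁻¹» `p0022:L12`; (4.18)–(4.21); «Of course both terms on the right side of (4.21) are ≥ 0, and
  η = L^{−k}, 0 < η < 1» `p0022:L25`; (4.22) with «where Δ₁ is any face of the block Δ … the expression on the right side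
  of (4.22) is a constant γ₀″⁻¹ depending on d and a only. Thus the inequality (4.14) is proved and the proof of
  Proposition 3.1′ is completed» `p0023:L7–L9`; census G-B4-08 = the η-uniformity of (4.22)): `B4Ineq412ConstField.
  ineq412_constBond`, `B4Ineq410GaugeOut.ineq412_iff_414`, `lhs47_mass_mono`, `B4Ineq414TwoBlock.ineq414`
  (B4Ineq414TwoBlock.lean:135), `ineq414_uniform`, `B4Eq415Gaussian.eq415_printed`, `B4Eq416Fourier.eq416_printed`,
  `eq418`, `eq421`, `eq421_terms_nonneg`, `A0_pos`, `ineq422_le`, `B4Eq417GaussFourier.eq417`, `eq420`,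
  `B4Eq418TwoBlockA0.gamma0''_le_A0`, `gamma0''_pos`, `ineq422_twoBlock`, `B4Ineq422.ineq422` (B4Ineq422.lean:613),
  `ineq422_eta`, `gamma0_inv_le` (the η-uniform face bound, G-B4-08 closed in the kernel); assembly
  `B4Prop31Sect4Route.prop31Printed_regularRegion_sect4` (B4Prop31Sect4Route.lean:730) — the §4 DELIVERY «Proposition
  3.1′ of [2]» = `B4.Prop31Printed` (stated p. 574, block 41).  Bundle `prop31`.
* p. 593 ll. 10–12 (`p0023:L10–L12`) «Remark. The argument applied in the proof of (4.14) is an example of an application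
  of "duality transformations". In our case this is an ordinary Fourier transform.» — prose, no mathematical content to
  type (the Fourier step is `B4Eq417GaussFourier.eq417` ∕ `eq420`).

### Sect. 5 «A General Theorem on Unit Lattice Operators», pp. 593–597 (`p0023:L13` – `p0027:L13`)
* row B4.Eq5.1 — (5.1)–(5.3) p. 593 («At first let us prove that the bounds (1.11) [= (1.15)] are consequences of
  Proposition II.3.1′. The upper bound is quite elementary because (5.1) … The operators are considered as defined on
  L²(Ω^{(k)}). To prove the lower bound we apply Proposition II.3.1′ to Δ^{(k)}(Ω,A): (5.2)» `p0023:L17–L22`; «Now we use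
  again the method we have applied so many times: … This sum is bounded from below by a positive constant (more precisely
  by ½γ₀min{π²L⁻², aL⁻²}), thus we have (5.3) for e sufficiently small and we get the lower bound» `p0023:L25–L35`, slip
  G-B4-03 recurring, located in `B4.Display227Printed`): `B4.recursion_51` (B4.lean:544), `B4Prop23Sect5Route.
  abs_kOp_apply_le` ((5.1) operator side), `B4NextAvg52.nextAvg`, `rowOrtho_nextAvg`, `covLap_unit_form` ((5.2)),
  `B4Ineq53RegularRegion.nBase`, `block_lower_regular`, `gamLow`, `form115_lower_regular` (B4Ineq53RegularRegion.lean: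
  319), `form115_upper_regular` ((5.3) ⇒ (1.15)).
* row B4.Eq5.4 — (5.4), (5.5) pp. 593–594 («Finally Corollary 2.3 implies that the considered operator is short-ranged in
  the sense that for some δ₀ > 0 (5.4) and a change of the domain Ω implies a change of the operator which can be
  estimated in the following way (5.5)» `p0023:L35` – `p0024:L3`): `B4Ineq116Torus.K2_decay_torus` (B4Ineq116Torus.lean:
  825), `B4Eq54RegularRegion.ineq54_regular`, `hyp56_regular`, `ineq55_regular`, `hyp59_regular`, `B4TwoRegion120.Dform`.
* p. 594 ll. 5–6 (`p0024:L5–L6`) «From these properties it follows that Proposition I.2.3 is a consequence of the following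
  Theorem»: PROVED as a route `B4Prop23Sect5Route.prop23_of_sect5` (B4Prop23Sect5Route.lean:401), `hyp56_kOp`,
  `hyp59_deltaK_sub`, and on concrete families `B4Prop23RegularWindow.prop23Printed_regularWindow` — the §5 DELIVERY of
  `B4.Prop23Printed` again.  Bundle `prop23`.
* rows B4.Thm@594, B4.Def§5 — THE THEOREM p. 594 (`p0024:L7–L20`) «Theorem. Let Ω ⊂ Z^d and let A be a symmetric
  operator defined on the space L²(Ω) of functions φ : Ω → R^N and satisfying the following condition: there exist
  positive constants γ₀, c₀, δ₀ such that A ≥ γ₀I, |A(x,x′)| ≤ c₀e^{−δ₀|x−x′|}, x, x′ ∈ Ω. (5.6) Then there exist positive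
  constants c₁, δ₁ such that for arbitrary Λ ⊂ Ω and for C_Λ = A_Λ⁻¹, A_Λ is an operator defined on L²(Λ) by A_Λ = ΛAΛ.
  We have (5.7), (5.8). If we perturb the operator A by an operator B such that the condition (5.6) is satisfied for
  A + B, and additionally B has the property (5.9) then we have also (5.10)» with p. 597 ll. 12–13 (`p0027:L12–L13`)
  «Thus Inequality (5.10) is proved. The constants δ₁, c₁ are functions of δ₀, γ₀, c₀, and from the above proof we can
  get more precise estimates for them.»: `B4.Idx`, `compress`, `Hyp56`, `Concl57_58`, `Hyp59`, `Concl510` (B4.lean:446–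
  496), the two quantifier readings `B4.Sect5ThmLiteral` ∕ `B4.Sect5ThmUniform` (B4.lean:509, 524; the p. 597 sentence =
  the uniform reading, `B4.sect5_literal_of_uniform`) — PROVED `B4Sect5Proof.sect5ThmUniform_holds`,
  `sect5ThmLiteral_holds` (B4Sect5Proof.lean:820, 826; explicit constants `cStar`, `deltaStar`, `sect5_explicit`); the
  print's full scope «Ω ⊂ Z^d» (possibly infinite) `B4Sect5Exhaustion.Sect5ThmSetOmega` — PROVED `sect5ThmSetOmega_holds`;
  the ℓ²-operator reading `B4Sect5L2.Sect5ThmL2` — PROVED `sect5ThmL2_holds`; the torus reading used by [B6] p. 250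
  `B4Sect5Torus.TorusSect5ThmUniform` — PROVED `torusSect5ThmUniform_holds`.  Bundle `sect5`.
* row B4.Eq5.11 — (5.11)–(5.14) pp. 594–595 («The proof goes along the lines of the proof of Proposition I.2.1. We start
  with a construction of a "generalized random walk" representation» `p0024:L22–L24`; «we introduce the same partition of
  unity h_j as before. In the sequel we restrict ourselves to these j's for which □_j ≠ ∅» `p0024:L26–L27`; «We will show
  again that C is a very good approximation of C_Λ in the sense that A_ΛC is almost an identity» `p0024:L29–L30`; «It is
  natural to interpret R_{j,j′} as an operator R_{j,j′} : L²(□_{j′}) → L²(□_j)» `p0025:L6–L7`): `B4Sect5RandomWalk.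
  CubeSystem` (B4Sect5RandomWalk.lean:100), `boxInd`, `cPar`, `rOp`, `rPair`, `parametrix513_printed` ((5.13)),
  `rOp_eq_sum_rPair` ((5.14)); built on ℤ^d `B4Sect5CubeBounds.prof`, `hfun`, `cand`, `labels`, `box`, `pFam`, `hFam`,
  `cOp`, `cFam`, `cubeSystem_lattice`.
* row B4.Eq5.15 — (5.15)–(5.27) pp. 595–597 (the two unnumbered kernel estimates of p. 595 «|R_{j,j}(x,x′)| = |A(x,x′)
  (h_j(x′) − h_j(x))| ≤ c₀e^{−δ₀|x−x′|}O(1)|x−x′|∕M …, |R_{j,j′}(x,x′)| … ≤ c₀e^{−⅓δ₀|x−x′|}e^{−⅙δ₀M}» `p0025:L8–L10`;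
  (5.15) «for α depending on M and arbitrarily small if M is sufficiently large, δ₂ depending on δ₀, e.g. δ₂ = ¼δ₀»
  `p0025:L11–L14`; the unnumbered Schur bound «‖R‖ ≤ max{sup_j Σ_{j′}‖R_{j,j′}‖, sup_{j′} Σ_j‖R_{j,j′}‖}γ₀⁻¹ ≤ αγ₀⁻¹
  Σ_{j∈Z^d} e^{−δ₂|j|} is small for M large» `p0025:L15–L17`; (5.16)–(5.18) with (5.17) «ω_i are arbitrary indices j,
  but satisfying the restrictions max_μ|ω_{2i,μ} − ω_{2i+1,μ}| ≤ 1» `p0025:L20–L24`; «If we define g₁(j) = e^{−δ₂|j|},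
  j ∈ Z, then the sum over j's in (5.18) can be written as Π_μ g_{2n}(j_μ − j′_μ), g_{2n} = g₁ * … * g₁ … The Fourier
  transform of g₁ is equal to …» `p0025:L30–L36`, (5.19), (5.20) «for some c₂» `p0026:L2–L4`; «Finally we fix M such
  that γ₀⁻¹αe^{dδ₂}c₂^{2d} < 1, and we get (5.21). This inequality implies (5.7) with δ₁ = ½δ₂M⁻¹» `p0026:L5–L10`; the
  (5.8) part «We define □′_j by the equality (5.11) with Ω instead of Λ, and C′_j = C_{□′_j}. If □′_j is disjoint with the
  complement Λᶜ of Λ in Ω, then □′_j = □_j and C′_j = C_j. Similarly if both □′_j, □′_{j′} are disjoint with Λᶜ, then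
  R′_{j,j′} = R_{j,j′}. … all terms corresponding to walks ω with □′_{ω_i} disjoint with Λᶜ are canceled … The range of
  ω′_i in the second sum might be larger because Ω ⊃ Λ» `p0026:L14–L26`, (5.22)–(5.23); the (5.10) part (5.24), «From the
  definition (5.14) of the operators R_{j,j′} we have R(A)_{j,j′} − R(A+B)_{j,j′} = −R(B)_{j,j′}, and from the condition
  (5.9), we get the estimate (5.25)» `p0027:L2–L4`, (5.26), (5.27) and the closing display p. 597): `B4Sect5CubeBounds.
  abs_rPair_diag_le`, `abs_rPair_offDiag_le` (the two kernel estimates), `alpha515`, `ineq515` (B4Sect5CubeBounds.lean: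
  1198), `ineq515_l2`, `alpha515_le` (α small for M large), `norm_rOp_le` (the Schur bound), `Adj`, `theta517`,
  `hasSum516_lattice`, `hasSum517_lattice` ((5.16)–(5.17)); `B4Sect5RandomWalk.Restr517`, `walkTerm517`, `hasSum516`,
  `hasSum517`; `B4Sect5Fourier519.g1`, `gn`, `zconv`, `symb`, `hasSum_fourier_g1`, `eq519_printed`, `ineq520_printed`,
  `c2`, `hasSum_chain_factorizes` ((5.18)–(5.20)); `B4.walk_to_distance` (B4.lean:554), `B4Sect5WalkDecay.
  concl57_compress_walk` ((5.21) ⇒ (5.7)); `B4Sect5WalkDelta.concl58_compress_walk`, `B4Sect5Proof.deltaC_eq`,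
  `deltaC_bound` ((5.22)–(5.23) ⇒ (5.8)); `B4Sect5WalkPerturb.rPair_sub_rPair_add` (R(A) − R(A+B) = −R(B)), `kernel59_le`
  ((5.25)), `cOp_sub_cOp_eq` ((5.26)), `l2norm_cOp_sub_cOp_le` ((5.27)), `concl510_compress_walk`, `B4Sect5Proof.
  inv_sub_inv_eq`, `perturb_bound` ((5.24)–(5.27) ⇒ (5.10)).

## WHAT THIS FILE ADDS
§1 SENTENCE CENSUS, residual = EMPTY.  Every numbered display (3.1)–(5.27) and every unnumbered printed statement of
pp. 586 l. 16 – 597 listed above has a declaration of record (searched 2026-08-28: `HOME/EXISTING-DECLS.tsv` rows of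
`Balaban1983RegularityDecay` with locators pp. 586–597 ∕ (3.·)–(5.·) — 222 def∕structure rows in 60 files — and `rg` over
`Balaban1983to89/B4*.lean` for each prose candidate of the block row: the q_k norms p. 588, the «only slight changes»
sentence p. 588, «G_k(Ω,A) ≤ ((a_kP_k(A)+m²)|_Ω)⁻¹» p. 589, the antisymmetry remark p. 591, «does not appear if A = 0»
p. 591, «A₀ ≥ γ₀″ … depends on d and a only» p. 592, «Δ₁ is any face» p. 593, the two kernel estimates and the Schur bound
p. 595, «we fix M» p. 596, «R(A) − R(A+B) = −R(B)» p. 597 — all located).  Hence NO `…Printed` definition is added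
(CARVE-RULES §2.3: never pad by restating); the three prose-only sentences (p. 588 «Generally we have to expect that bounds
on C^{(k)}_Λ(Ω,A) will depend on L», p. 590 «Formally we could rely on the estimates of perturbative expansions in the
third paper [3] …», p. 593 «Remark … duality transformations») carry no statement to type and are quoted in the docstrings
of `B4.Prop23Printed` ∕ this table.
§2 THE BUNDLE.  `Carriers` — the data the printed statements of Sects. 3–5 are typed over in the tree: the «Proposition
2.3 of [1]» family `famU` (`B4.UnitSetting`, delivered by Sect. 3 p. 589 and again by Sect. 5 p. 594), the «Proposition
3.1′ of [2]» family `famF` (`B4.FormSetting`, delivered by Sect. 4 p. 593), and `(d, N)` of the Sect. 5 Theorem — exactly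
the B4 fields `famU`, `famF`, `d4`, `N4` of `DagBinding.PrintedCarriers` (the Theorem p. 573 family `famE` is block 41's).
`Hyp X` — the section's printed statements AS HYPOTHESES, BY NAME, in page order: (3.1) `e31`, (3.3) `e33`, (3.6) `e36`
(the three displayed formulas of Sect. 3 that the tree types as `Prop`s, universally over their data as print states them),
the Sect. 3∕5 delivery `prop23`, the Sect. 4 delivery `prop31`, the Theorem p. 594 `sect5` (uniform reading).
§3 BOOKKEEPING (kernel-checked uses of the cited declarations; nothing of Bałaban's asserted anew): four of the six slots
ARE THEOREMS of the tree (`B4Gauss33Proof.gaussCovariance`, `B4Gauss33Proof.gauss33`, `B4GaussRep36Proof.rep36`,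
`B4Sect5Proof.sect5ThmUniform_holds`, used by name), so `Hyp.ofDeliveries` builds the bundle from the two p. 574
propositions alone and `hyp_iff_deliveries` records `Hyp X ↔ Prop23Printed ∧ Prop31Printed`; consumer forms
`Hyp.sect5Literal` (literal reading), `Hyp.concl57_58` ∕ `Hyp.concl510` ((5.7)–(5.8), (5.10) unpacked for a given (γ₀, c₀,
δ₀)), `Hyp.leafB4` (with block 41's Theorem p. 573 ⇒ `B4.LeafB4`, the B4 leaf of the series DAG), `hyp_of_leafB4`
(conversely), `Carriers.ofDag` + `Hyp.dag_b4` (⇒ `(DagBinding.Upstream.ofPrinted Xc …).b4`, the leaf the K⁷ consumer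
`stmt-QuantumFields-20542` binds), `hyp_ofDag_of_b4` and `dag_b4_iff_deliveries`.  Non-vacuity (scratch of the seat, not
shipped): `Hyp` is inhabited at a (1.7)-regular background field A ≠ 0 on the lineage's concrete families by
`B4Prop23RegularWindow.prop23Printed_regularWindow_rot` and `B4Prop31Regular.prop31Printed_regularRegion_rot`.

RULING #9 (standing smallness): the only smallness parameter of these pages is the charge e («for e sufficiently small»,
pp. 574, 593); it enters the bundle only through the thresholded binders `∃ … e₁ > 0, ∀ i, 0 < e ≤ e₁ → …` of the cited
`B4.Prop23Printed` ∕ `B4.Prop31Printed` (shape of record); M of Sect. 5 («M large», p. 595–596) is fixed inside the proof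
(`B4Sect5Proof.sect5_explicit`) and is not a parameter of the Theorem.

## HONEST SCOPE
Nothing of [B4] is proved here beyond bookkeeping; Props. 2.3 ∕ 3.1′ are hypothesis slots by name (their PROOFS on the
lineage's concrete families are the tree's `B4Prop23RegularWindow.prop23Printed_regularWindow`, `B4Prop31Regular.
prop31Printed_regularRegion`, `B4Prop31Sect4Route.prop31Printed_regularRegion_sect4`, knitted in `B4LeafRegular`); the
typed readings and their located divergences (finite Ω D-b04.5, entrywise kernel bounds D-b04.6, «dependent on d and M
only» silently including L D-b04.4, the (2.27)-constant slip G-B4-03, the sign of (3.9)) are those of the cited modules,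
not re-adjudicated.  No summit statement is proved by this seat; K1⁷ is not discharged; count-neutral; nothing continuum ∕
ℝ⁴ ∕ OS ∕ mass-gap ∕ Clay.  No `sorry`, no `instance`, no `notation`.
-/

namespace Literature.MathematicalPhysics.QuantumFieldTheory.Balaban1983to89.B4Carve42Sects345Hyp

/-! ## §2  The bundle: the printed statements of Sects. 3–5 as hypotheses, by name -/

/-- **Carriers of the block-42 bundle**: the data over which the tree types the printed statements of pp. 586–597 that
carry instance data — the family `famU` of «Proposition 2.3 of [1]» (`B4.UnitSetting`: k, Ω ⊂ Ω₀, A, e, Λ; the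
proposition PROVED in Sect. 3, pp. 586–589, and again in Sect. 5, p. 594), the family `famF` of «Proposition 3.1′ of [2]»
(`B4.FormSetting`: k, Ω, A, e, m²; PROVED in Sect. 4, pp. 589–593), and the dimension `d` and number of components `N` of
the Sect. 5 Theorem p. 594 («Ω ⊂ Z^d», «φ : Ω → R^N»).  Exactly the B4 fields `famU`, `famF`, `d4`, `N4` of
`DagBinding.PrintedCarriers` (`Carriers.ofDag`).  Plain data, no instances. [cite: Balaban1983RegularityDecay, Sects. 3–5 pp.586–597; Props. p.574; Theorem p.594] -/
structure Carriers where
  I4U : Type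
  famU : I4U → B4.UnitSetting
  I4F : Type
  famF : I4F → B4.FormSetting
  d : ℕ
  N : ℕ

/-- **BLOCK 42 BUNDLE — the printed statements of [Balaban1983RegularityDecay] Sects. 3–5 (pp. 586–597) AS HYPOTHESES,
BY NAME**, in page order; one field per statement, each a reference to the declaration of record typing it (nothing
restated; the verbatim quotations are in those declarations' docstrings and in this module's table):
`e31` — **(3.1)** p. 586, first equality «C^{(k)}_Λ(Ω,A;y,y′) = ((Δ^{(k)}(Ω,A) + aL⁻²P(A))|_Λ)⁻¹(y,y′) = (Z^{(k)}_Λ(Ω,A))⁻¹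
∫dψ|_Λ … ψ(y)ψ*(y′)», its folklore content (Gaussian covariance = inverse precision) for every finite index type
(`B4GaussRep36.GaussCovariance`); `e33` — **(3.3)** p. 587 «We apply the general formula ∫Π_{j=1}^N dx_j{1, x_j, x_jx_k}
exp[−½A(Σx_j)² − ½BΣx_j² + CΣx_j] = {1, C∕(NA+B), (C∕(NA+B))² − A∕(B(NA+B)) + δ_{j,k}∕B}·(2π)^{N∕2}((NA+B)B^{N−1})^{−1∕2}
exp(½NC²∕(NA+B))» for all N, A, B, C (`B4GaussRep36.Gauss33`, whose body carries the convergence hypotheses);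
`e36` — **(3.6)** p. 588 «we have finally C^{(k)}_Λ(Ω,A;y,y′) = ([−(a_{k+1}∕a_k)L⁻²Q*(A)Q_{k+1}(A) + Q_k(A)]G_k(Ω,Λ,A)
[−(a_{k+1}∕a_k)L⁻²Q*_{k+1}(A)Q(A) + Q_k*(A)])(y,y′) − (a_{k+1}∕a_k²)L⁻²P(A;y,y′) + δ_{y,y′}∕a_k» for all data
(`B4GaussRep36.Rep36`, whose body carries the hypotheses making both sides meaningful); `prop23` — **«This ends the proof
of Proposition I.2.3»** p. 589 and **«Proposition I.2.3 is a consequence of the following Theorem»** p. 594: «Proposition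
2.3 of [1]» (1.15)–(1.20) for the family (`B4.Prop23Printed`, stated p. 574); `prop31` — **«Thus the inequality (4.14) is
proved and the proof of Proposition 3.1′ is completed»** p. 593: «Proposition 3.1′ of [2]» (1.21)–(1.22) for the family
(`B4.Prop31Printed`, stated p. 574); `sect5` — **THEOREM p. 594** (5.6) ⇒ (5.7), (5.8), and with (5.9) also (5.10), in
the uniform reading fixed by p. 597 «The constants δ₁, c₁ are functions of δ₀, γ₀, c₀» (`B4.Sect5ThmUniform`).
Hypothesis slot only. [cite: Balaban1983RegularityDecay, (3.1) p.586, (3.3) p.587, (3.6) p.588, p.589 l.6–7, p.593 l.9, Theorem (5.6)–(5.10) p.594 + p.597] -/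
structure Hyp (X : Carriers) : Prop where
  e31 : ∀ (n : Type) [Fintype n] [DecidableEq n], B4GaussRep36.GaussCovariance n
  e33 : ∀ (N : ℕ) (A B C : ℝ), B4GaussRep36.Gauss33 N A B C
  e36 : ∀ (S Y Z : Type) [Fintype S] [Fintype Y] [Fintype Z] [DecidableEq S] [DecidableEq Y] [DecidableEq Z]
    (H : Matrix S S ℝ) (ak : ℝ) (Qk : Matrix Y S ℝ) (a ℓ w : ℝ) (Q : Matrix Z Y ℝ) (Λ : Finset Y) (Λ' : Finset Z),
    B4GaussRep36.Rep36 H ak Qk a ℓ w Q Λ Λ'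
  prop23 : B4.Prop23Printed X.famU
  prop31 : B4.Prop31Printed X.famF
  sect5 : B4.Sect5ThmUniform X.d X.N

/-! ## §3  Bookkeeping (kernel-checked uses of the cited declarations; no statement asserted) -/

variable {X : Carriers}

/-- **The bundle from the block's two delivered propositions**: four of the six slots ARE theorems of the tree, used here
by name — `e31` = `B4Gauss33Proof.gaussCovariance` ((3.1)'s folklore content in every finite dimension), `e33` =
`B4Gauss33Proof.gauss33` (the general formula (3.3)), `e36` = `B4GaussRep36Proof.rep36` ((3.6) for all data, two-way
Schur complement), `sect5` = `B4Sect5Proof.sect5ThmUniform_holds` (the Theorem p. 594, explicit constants `cStar`,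
`deltaStar`) — so `Hyp X` is built from «Proposition 2.3 of [1]» and «Proposition 3.1′ of [2]» for the families alone (the
statements whose PROOFS are Sects. 3 and 4). [cite: Balaban1983RegularityDecay, (3.1) p.586, (3.3) p.587, (3.6) p.588, p.589 l.6–7, p.593 l.9, Theorem p.594 (bookkeeping)] -/
theorem Hyp.ofDeliveries (h23 : B4.Prop23Printed X.famU) (h31 : B4.Prop31Printed X.famF) : Hyp X :=
  ⟨fun n _ _ => B4Gauss33Proof.gaussCovariance n, fun N A B C => B4Gauss33Proof.gauss33 N A B C,
   fun _ _ _ _ _ _ _ _ _ H ak Qk a ℓ w Q Λ Λ' => B4GaussRep36Proof.rep36 H ak Qk a ℓ w Q Λ Λ', h23, h31,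
   B4Sect5Proof.sect5ThmUniform_holds X.d X.N⟩

/-- Hence the bundle is EQUIVALENT to the conjunction of the two p. 574 propositions on the carriers (the block's net
hypothesis content). [cite: Balaban1983RegularityDecay, Props. p.574 with Sects. 3–5 pp.586–597 (bookkeeping)] -/
theorem hyp_iff_deliveries : Hyp X ↔ B4.Prop23Printed X.famU ∧ B4.Prop31Printed X.famF :=
  ⟨fun h => ⟨h.prop23, h.prop31⟩, fun h => Hyp.ofDeliveries h.1 h.2⟩

/-- The Theorem p. 594 in its LITERAL quantifier reading (c₁, δ₁ after (Ω, A)) from the bundle's uniform slot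
(`B4.sect5_literal_of_uniform`). [cite: Balaban1983RegularityDecay, Theorem (5.6)–(5.10) p.594] -/
theorem Hyp.sect5Literal (h : Hyp X) : B4.Sect5ThmLiteral X.d X.N :=
  B4.sect5_literal_of_uniform h.sect5

/-- **(5.7)–(5.8) unpacked**: for given positive (γ₀, c₀, δ₀) ONE pair (c₁, δ₁) such that every finite Ω ⊂ ℤ^d, every A
with (5.6) and every Λ ⊂ Ω satisfy «|C_Λ(x,x′)| ≤ c₁e^{−δ₁|x−x′|}» and «|δC_Λ(x,x′)| ≤ c₁e^{−δ₁(|x−x′| + dist(x,Λᶜ) +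
dist(x′,Λᶜ))}» in the tree's typing `B4.Concl57_58`. [cite: Balaban1983RegularityDecay, (5.6)–(5.8) p.594] -/
theorem Hyp.concl57_58 (h : Hyp X) {γ₀ c₀ δ₀ : ℝ} (hγ : 0 < γ₀) (hc : 0 < c₀) (hδ : 0 < δ₀) :
    ∃ c₁ δ₁ : ℝ, 0 < c₁ ∧ 0 < δ₁ ∧
      ∀ (Ω : Finset (Fin X.d → ℤ)) (A : Matrix (B4.Idx Ω X.N) (B4.Idx Ω X.N) ℝ), B4.Hyp56 Ω A γ₀ c₀ δ₀ →
        ∀ (Λ : Finset (Fin X.d → ℤ)) (hΛ : Λ ⊆ Ω), B4.Concl57_58 Ω Λ hΛ A c₁ δ₁ := by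
  obtain ⟨c₁, δ₁, hc₁, hδ₁, H⟩ := h.sect5 γ₀ c₀ δ₀ hγ hc hδ
  exact ⟨c₁, δ₁, hc₁, hδ₁, fun Ω A hA Λ hΛ => (H Ω A hA).1 Λ hΛ⟩

/-- **(5.10) unpacked**: with the same (c₁, δ₁), every perturbation B with (5.6) for A + B and (5.9) satisfies
«|A_Λ⁻¹(x,x′) − (A+B)_Λ⁻¹(x,x′)| ≤ c₁e^{−δ₁(|x−x′| + dist(x,Ωᶜ) + dist(x′,Ωᶜ))}» in the tree's typing `B4.Concl510`.
[cite: Balaban1983RegularityDecay, (5.9)–(5.10) p.594] -/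
theorem Hyp.concl510 (h : Hyp X) {γ₀ c₀ δ₀ : ℝ} (hγ : 0 < γ₀) (hc : 0 < c₀) (hδ : 0 < δ₀) :
    ∃ c₁ δ₁ : ℝ, 0 < c₁ ∧ 0 < δ₁ ∧
      ∀ (Ω : Finset (Fin X.d → ℤ)) (A : Matrix (B4.Idx Ω X.N) (B4.Idx Ω X.N) ℝ), B4.Hyp56 Ω A γ₀ c₀ δ₀ →
        ∀ B : Matrix (B4.Idx Ω X.N) (B4.Idx Ω X.N) ℝ, B4.Hyp56 Ω (A + B) γ₀ c₀ δ₀ → B4.Hyp59 Ω B c₀ δ₀ →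
          ∀ (Λ : Finset (Fin X.d → ℤ)) (hΛ : Λ ⊆ Ω), B4.Concl510 Ω Λ hΛ A B c₁ δ₁ := by
  obtain ⟨c₁, δ₁, hc₁, hδ₁, H⟩ := h.sect5 γ₀ c₀ δ₀ hγ hc hδ
  exact ⟨c₁, δ₁, hc₁, hδ₁, fun Ω A hA B hAB hB Λ hΛ => (H Ω A hA).2 B hAB hB Λ hΛ⟩

/-- **The B4 leaf of the series DAG from the bundle and block 41's Theorem p. 573**: `B4.LeafB4 famE famU famF d N =
ThmPrinted famE ∧ Prop23Printed famU ∧ Prop31Printed famF ∧ Sect5ThmUniform d N` («Theorem p. 573, Prop. 2.3 of I and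
Prop. 3.1′ of II as restated p. 574, Sect. 5 Theorem p. 594»), by `B4.leafB4_intro`. [cite: Balaban1983RegularityDecay, Theorem p.573, Props. p.574, Theorem p.594 (bookkeeping)] -/
theorem Hyp.leafB4 (h : Hyp X) {I₁ : Type} {famE : I₁ → B4.EtaSetting} (hThm : B4.ThmPrinted famE) :
    B4.LeafB4 famE X.famU X.famF X.d X.N :=
  B4.leafB4_intro hThm h.prop23 h.prop31 h.sect5

/-- Conversely every B4 leaf over the carriers contains the bundle (its Sect. 3 formula slots being theorems).
[cite: Balaban1983RegularityDecay, Props. p.574, Theorem p.594 (bookkeeping)] -/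
theorem hyp_of_leafB4 {I₁ : Type} {famE : I₁ → B4.EtaSetting} (h : B4.LeafB4 famE X.famU X.famF X.d X.N) : Hyp X :=
  Hyp.ofDeliveries h.2.1 h.2.2.1

/-- The carriers of this block read off the DAG's record `DagBinding.PrintedCarriers` (its B4 fields `famU`, `famF`, `d4`,
`N4`; the Theorem p. 573 family `famE` is block 41's and enters `Hyp.dag_b4` as a hypothesis). [cite: Balaban1983RegularityDecay, Props. p.574, Theorem p.594 (bookkeeping)] -/
def Carriers.ofDag (Xc : DagBinding.PrintedCarriers) : Carriers where
  I4U := Xc.I4U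
  famU := Xc.famU
  I4F := Xc.I4F
  famF := Xc.famF
  d := Xc.d4
  N := Xc.N4

/-- **The DAG's `b4` leaf**: at the carriers of `DagBinding.PrintedCarriers`, the bundle together with the Theorem p. 573
(block 41) IS the upstream leaf `b4 = B4.LeafB4 X.famE X.famU X.famF X.d4 X.N4` of `DagBinding.Upstream.ofPrinted` (node
[B4] of the K⁷ consumer `stmt-QuantumFields-20542`).  Bookkeeping. [cite: Balaban1983RegularityDecay, Theorem p.573, Props. p.574, Theorem p.594 (bookkeeping)] -/
theorem Hyp.dag_b4 {Xc : DagBinding.PrintedCarriers} (h : Hyp (Carriers.ofDag Xc)) (hThm : B4.ThmPrinted Xc.famE)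
    (b9 b11 rOp rBS : Prop) : (DagBinding.Upstream.ofPrinted Xc b9 b11 rOp rBS).b4 :=
  (show B4.LeafB4 Xc.famE Xc.famU Xc.famF Xc.d4 Xc.N4 from h.leafB4 hThm)

/-- Conversely the DAG's bound `b4` leaf yields the bundle at the DAG's carriers. [cite: Balaban1983RegularityDecay, Props. p.574, Theorem p.594 (bookkeeping)] -/
theorem hyp_ofDag_of_b4 {Xc : DagBinding.PrintedCarriers} {b9 b11 rOp rBS : Prop}
    (h : (DagBinding.Upstream.ofPrinted Xc b9 b11 rOp rBS).b4) : Hyp (Carriers.ofDag Xc) :=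
  hyp_of_leafB4 (famE := Xc.famE) (show B4.LeafB4 Xc.famE Xc.famU Xc.famF Xc.d4 Xc.N4 from h)

/-- With block 41's Theorem p. 573 the DAG's `b4` leaf is EQUIVALENT to the conjunction of the two p. 574 propositions at
the DAG's carriers (the fourth conjunct, the Theorem p. 594, being proved: `B4Sect5Proof.leafB4_of_printed`).
[cite: Balaban1983RegularityDecay, Theorem p.573, Props. p.574, Theorem p.594 (bookkeeping)] -/
theorem dag_b4_iff_deliveries {Xc : DagBinding.PrintedCarriers} (hThm : B4.ThmPrinted Xc.famE) (b9 b11 rOp rBS : Prop) :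
    (DagBinding.Upstream.ofPrinted Xc b9 b11 rOp rBS).b4 ↔ B4.Prop23Printed Xc.famU ∧ B4.Prop31Printed Xc.famF :=
  ⟨fun h => ⟨(hyp_ofDag_of_b4 h).prop23, (hyp_ofDag_of_b4 h).prop31⟩,
   fun h => (Hyp.ofDeliveries (X := Carriers.ofDag Xc) h.1 h.2).dag_b4 hThm b9 b11 rOp rBS⟩

end Literature.MathematicalPhysics.QuantumFieldTheory.Balaban1983to89.B4Carve42Sects345Hyp
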